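import Summits.ValiantsHypothesis.ValiantsHypothesis.Theorems.KPlusLogSqLawSymmetricDesigns
import Summits.ValiantsHypothesis.ValiantsHypothesis.Theorems.LacunarySymmetroidMatrixDescartesCensusFrame

/-!
# Route «KPlusLogSqLaw» — the DIAGONAL `K`-class design: the census floors `T(m,K) ≥ m(K−1)` and `ζ₊(m,K) ≥ m(K−1)`
# for EVERY format, the second through symmetric patchworking (toward crux `Lifting`, stmt-ValiantsHypothesis-19772)

HONEST FRAMING.  Object-search cell `pub-symmetroid`, Conjecture-B route `KPlusLogSqLaw`.  An explicit SYMMETRIC tropical design (diagonal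
support) and the two census FLOORS it certifies — far below Descartes (`C(m+K−1,m) − 1`), far below the window of Conjecture B; nothing here
bears on `Lifting`/`TropicalB` in the window, on `KPlusLogSqLaw`, `MatrixDescartes`, a Door-A numeral or `VP ≠ VNP`.  Its point is the
PIPELINE: a symmetric design typed in the dominance vocabulary becomes a kernel LOWER bound of the real symmetric census at the SAME format via
`symmDesign_le_of_posRootLawAt` (`KPlusLogSqLawSymmetricDesigns`), with no `(2m, K+1)` doubling — the route by which better symmetric designs
(e.g. the cell's `T_sym(2,K) = 3K − 4` configurations, PATCHWORK-CEILING.md) turn into census rows.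

THE DESIGN `DiagK` (format `(m, K)`, `K ≥ 2`).  Slopes `d_l = l`; presence on the diagonal only, `ε(b,b,l) = (−1)^l`; valuations
`v(b,b,l) = 2b(K−1)·l + l²`, so that in row `b` class `j` beats class `j − 1` exactly when `θ > 2(b(K−1) + j) − 1`.  CHAIN: `θ_k = 2k`,
`k = 0 … m(K−1)`, term `(1, λ_k)` with `λ_k(b) = min(K−1, k − b(K−1))` (rows fill up one class at a time, row after row).  Only the identity
permutation is present; the weight is the sum of the row scores `l(2c − l)`, `c = k − b(K−1)`, uniquely maximised at the clamp (`rowScore_lt`);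
from `k` to `k+1` exactly the row `⌊k/(K−1)⌋` moves up one class (`cl_succ`), so consecutive signs alternate (`alternates`).

RESULTS (all proved): `isDominant_tgt`; `le_of_tropRootLawAt : 2 ≤ K → TropRootLawAt m K B → m(K−1) ≤ B` (tropical floor);
`le_of_posRootLawAt : 2 ≤ K → PosRootLawAt m K B → m(K−1) ≤ B` (real floor, symmetric patchworking); **`not_posRootLawAt : 2 ≤ K → 1 ≤ m →
¬ PosRootLawAt m K (m(K−1) − 1)`** and `not_realRootLawAt` — `ζ₊(m,K) ≥ m(K−1)` for every format (the tree had the rows `Census.row_two`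
(`K = 2`), `Census.row_one` (`m = 1`) and finitely many census cells). [folklore]
-/

set_option linter.dupNamespace false
set_option autoImplicit false

namespace Summit.ValiantsHypothesis.ValiantsHypothesis.Theorems.LacunarySymmetroidMatrixDescartes.TropicalCensus.DiagK

open Summit.ValiantsHypothesis.ValiantsHypothesis.Theorems.MatrixDescartes.Negative
open Summit.ValiantsHypothesis.ValiantsHypothesis.Theorems.LacunarySymmetroidMatrixDescartes
open scoped BigOperators
open Finset

variable (m K : ℕ)

/-- slopes `d_l = l`. [folklore] -/
def dd : Fin K → ℕ := fun l => (l : ℕ)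

/-- diagonal-only presence, class `l` on the diagonal carries the sign `(−1)^l`. [folklore] -/
def ee : Fin m → Fin m → Fin K → ℤ := fun a b l => if a = b then (-1) ^ (l : ℕ) else 0

/-- valuations: `v(b,b,l) = 2 b (K−1) l + l²` (row `b` switches from class `j−1` to class `j` at the odd slope
`2(b(K−1)+j) − 1`); zero off the diagonal. [folklore] -/
def vv : Fin m → Fin m → Fin K → ℤ := fun a b l =>
  if a = b then 2 * (b : ℤ) * ((K : ℤ) - 1) * (l : ℕ) + ((l : ℕ) : ℤ) ^ 2 else 0

/-- the class of row `b` at step `k`: `min (K−1) (k − b(K−1))` (natural subtraction clamps at `0`). [folklore] -/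
def cl (k : ℕ) (b : Fin m) : ℕ := min (K - 1) (k - (b : ℕ) * (K - 1))

/-- the clamped class is a valid class index. [folklore] -/
theorem cl_lt (hK : 1 ≤ K) (k : ℕ) (b : Fin m) : cl m K k b < K := by
  unfold cl; omega

/-- the class profile at step `k`. [folklore] -/
def lam (hK : 1 ≤ K) (k : ℕ) : Fin m → Fin K := fun b => ⟨cl m K k b, cl_lt m K hK k b⟩

/-- the chain term at step `k`: identity permutation, class profile `lam k`. [folklore] -/
def tgt (hK : 1 ≤ K) (k : ℕ) : Equiv.Perm (Fin m) × (Fin m → Fin K) := (1, lam m K hK k)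

/-- the slopes of the chain: `θ_k = 2k`. [folklore] -/
def th (k : ℕ) : ℤ := 2 * k

/-! ### Symmetry and size of the data -/

/-- the valuations are symmetric. [folklore] -/
theorem vv_symm (a b : Fin m) (l : Fin K) : vv m K a b l = vv m K b a l := by
  unfold vv
  by_cases h : a = b
  · subst h; rfl
  · rw [if_neg h, if_neg (Ne.symm h)]

/-- the presence/sign pattern is symmetric. [folklore] -/
theorem ee_symm (a b : Fin m) (l : Fin K) : ee m K a b l = ee m K b a l := by
  unfold ee
  by_cases h : a = b
  · subst h; rfl
  · rw [if_neg h, if_neg (Ne.symm h)]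

/-- signs lie in `{−1, 0, 1}`. [folklore] -/
theorem ee_natAbs (a b : Fin m) (l : Fin K) : (ee m K a b l).natAbs ≤ 1 := by
  unfold ee
  split_ifs
  · rw [Int.natAbs_pow]; simp
  · simp

/-! ### Present terms use the identity permutation; the weight is a sum of per-row scores -/

/-- a present term uses the identity permutation (the support is the diagonal). [folklore] -/
theorem perm_eq_one_of_present {q : Equiv.Perm (Fin m) × (Fin m → Fin K)} (hq : termSign (ee m K) q ≠ 0) :
    q.1 = 1 := by
  unfold termSign at hq
  have hprod : ∏ i, ee m K (q.1 i) i (q.2 i) ≠ 0 := fun h => hq (by rw [h, mul_zero])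
  rw [Finset.prod_ne_zero_iff] at hprod
  refine Equiv.ext fun i => ?_
  have hi := hprod i (Finset.mem_univ i)
  unfold ee at hi
  by_contra hne
  exact hi (if_neg hne)

/-- per-row score at slope `θ`: `θ·l − 2b(K−1)l − l²`. [folklore] -/
def rowScore (θ : ℤ) (b : Fin m) (l : Fin K) : ℤ :=
  θ * (l : ℕ) - (2 * (b : ℤ) * ((K : ℤ) - 1) * (l : ℕ) + ((l : ℕ) : ℤ) ^ 2)

/-- the weight of an identity term is the sum of its row scores. [folklore] -/
theorem tropWeight_one (θ : ℤ) (la : Fin m → Fin K) :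
    tropWeight (dd K) (vv m K) θ (1, la) = ∑ b, rowScore m K θ b (la b) := by
  unfold tropWeight rowScore dd vv
  simp only [Equiv.Perm.coe_one, id_eq, if_true]
  rw [Finset.mul_sum, ← Finset.sum_sub_distrib]

/-! ### The per-row optimum is the clamp -/

/-- `l(2c − l)` is uniquely maximised over `0 ≤ l ≤ K−1` at the clamp of `c` to `[0, K−1]`. [folklore] -/
theorem rowScore_lt (hK : 1 ≤ K) (k : ℕ) (b : Fin m) (l : Fin K) (hl : l ≠ lam m K hK k b) :
    rowScore m K (th k) b l < rowScore m K (th k) b (lam m K hK k b) := by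
  unfold rowScore th lam cl
  simp only []
  have hlK : (l : ℕ) ≤ K - 1 := by have := l.isLt; omega
  have hlne : (l : ℕ) ≠ min (K - 1) (k - (b : ℕ) * (K - 1)) := fun h => hl (Fin.ext h)
  -- abbreviations in ℤ
  set L : ℤ := ((l : ℕ) : ℤ) with hL
  set c : ℤ := (k : ℤ) - (b : ℤ) * ((K : ℤ) - 1) with hc
  have hK1 : ((K - 1 : ℕ) : ℤ) = (K : ℤ) - 1 := by omega
  -- the score is `2 L c − L²` in terms of `c`
  have key : ∀ x : ℕ, (2 * (k : ℤ)) * (x : ℕ) - (2 * (b : ℤ) * ((K : ℤ) - 1) * (x : ℕ) + ((x : ℕ) : ℤ) ^ 2)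
      = 2 * ((x : ℕ) : ℤ) * c - ((x : ℕ) : ℤ) ^ 2 := fun x => by rw [hc]; ring
  rw [key, key]
  rcases Nat.lt_or_ge k ((b : ℕ) * (K - 1)) with h0 | h0
  · -- c < 0: clamp = 0
    have hmin : min (K - 1) (k - (b : ℕ) * (K - 1)) = 0 := by
      rw [Nat.sub_eq_zero_of_le h0.le]; simp
    rw [hmin]
    have hc0 : c < 0 := by
      have : (k : ℤ) < (b : ℤ) * ((K : ℤ) - 1) := by
        rw [← hK1]; exact_mod_cast h0
      rw [hc]; linarith
    have hl1 : (1 : ℤ) ≤ L := by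
      have : (l : ℕ) ≠ 0 := by rw [hmin] at hlne; exact hlne
      have : 1 ≤ (l : ℕ) := Nat.one_le_iff_ne_zero.mpr this
      rw [hL]; exact_mod_cast this
    push_cast
    nlinarith
  · have hcnn : (0 : ℤ) ≤ c ∧ c = ((k - (b : ℕ) * (K - 1) : ℕ) : ℤ) := by
      have e : ((k - (b : ℕ) * (K - 1) : ℕ) : ℤ) = (k : ℤ) - (b : ℤ) * ((K : ℤ) - 1) := by
        rw [← hK1]; push_cast [Nat.cast_sub h0]; ring
      refine ⟨?_, by rw [hc, e]⟩
      rw [hc, ← e]; positivity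
    obtain ⟨hc0, hce⟩ := hcnn
    rcases Nat.lt_or_ge (k - (b : ℕ) * (K - 1)) (K - 1) with h1 | h1
    · -- 0 ≤ c < K−1: clamp = c
      have hmin : min (K - 1) (k - (b : ℕ) * (K - 1)) = k - (b : ℕ) * (K - 1) := Nat.min_eq_right h1.le
      rw [hmin]
      rw [hmin] at hlne
      have hne : L ≠ c := by
        rw [hce, hL]; exact_mod_cast hlne
      have hsq : 0 < (L - c) ^ 2 := by positivity
      rw [← hce]
      nlinarith
    · -- c ≥ K−1: clamp = K−1, and l < K−1
      have hmin : min (K - 1) (k - (b : ℕ) * (K - 1)) = K - 1 := Nat.min_eq_left h1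
      rw [hmin]
      rw [hmin] at hlne
      have hlt : (l : ℕ) < K - 1 := lt_of_le_of_ne hlK hlne
      have hL1 : L + 1 ≤ (K : ℤ) - 1 := by
        rw [hL, ← hK1]; exact_mod_cast hlt
      have hcK : (K : ℤ) - 1 ≤ c := by rw [hce, ← hK1]; exact_mod_cast h1
      rw [hK1]
      have hL0 : (0 : ℤ) ≤ L := by rw [hL]; positivity
      nlinarith

/-! ### Dominance, signs, the chain -/

/-- the sign factor of the chain term in row `b` is `(−1)^(class)`. [folklore] -/
theorem ee_tgt (hK : 1 ≤ K) (k : ℕ) (b : Fin m) :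
    ee m K ((1 : Equiv.Perm (Fin m)) b) b (lam m K hK k b) = (-1) ^ (cl m K k b) := by
  unfold ee lam; simp

/-- the chain terms are present. [folklore] -/
theorem termSign_tgt_ne_zero (hK : 1 ≤ K) (k : ℕ) : termSign (ee m K) (tgt m K hK k) ≠ 0 := by
  unfold termSign tgt
  simp only [Equiv.Perm.sign_one, Units.val_one, one_mul]
  rw [Finset.prod_ne_zero_iff]
  intro b _
  rw [ee_tgt]
  exact pow_ne_zero _ (by norm_num)

/-- **Dominance**: at `θ = 2k` the term `(1, lam k)` is the unique optimum. -/
theorem isDominant_tgt (hK : 1 ≤ K) (k : ℕ) :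
    IsDominant (dd K) (vv m K) (ee m K) (th k) (tgt m K hK k) := by
  refine ⟨termSign_tgt_ne_zero m K hK k, fun q hne hpres => ?_⟩
  have hq1 := perm_eq_one_of_present m K hpres
  have hq : q = (1, q.2) := Prod.ext hq1 rfl
  have hne2 : q.2 ≠ lam m K hK k := by
    intro h; apply hne; rw [hq, h]; rfl
  obtain ⟨b0, hb0⟩ : ∃ b, q.2 b ≠ lam m K hK k b := by
    by_contra h; push Not at h; exact hne2 (funext h)
  rw [hq, tropWeight_one]
  unfold tgt
  rw [tropWeight_one]
  refine Finset.sum_lt_sum (fun b _ => ?_) ⟨b0, Finset.mem_univ _, rowScore_lt m K hK k b0 _ hb0⟩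
  by_cases h : q.2 b = lam m K hK k b
  · rw [h]
  · exact (rowScore_lt m K hK k b _ h).le

/-- from step `k` to step `k+1` exactly the row `⌊k/(K−1)⌋` moves up one class. -/
theorem cl_succ (hK : 2 ≤ K) (k : ℕ) (b : Fin m) :
    cl m K (k + 1) b = cl m K k b + if (b : ℕ) = k / (K - 1) then 1 else 0 := by
  unfold cl
  have hK1 : 0 < K - 1 := by omega
  have h1 := Nat.div_add_mod k (K - 1)
  have h2 := Nat.mod_lt k hK1
  split_ifs with hb
  · -- the moving row: `b(K−1) ≤ k < (b+1)(K−1)`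
    have hlo : (b : ℕ) * (K - 1) ≤ k := by rw [hb]; exact Nat.div_mul_le_self k (K - 1)
    have hhi : k < (b : ℕ) * (K - 1) + (K - 1) := by rw [hb, Nat.mul_comm]; omega
    rw [Nat.min_eq_right (by omega), Nat.min_eq_right (by omega)]
    omega
  · rcases Nat.lt_or_gt_of_ne hb with hlt | hgt
    · -- b < k/(K-1): the row is full at both steps
      have hfull : ((b : ℕ) + 1) * (K - 1) ≤ k :=
        calc ((b : ℕ) + 1) * (K - 1) = (K - 1) * ((b : ℕ) + 1) := Nat.mul_comm _ _
          _ ≤ (K - 1) * (k / (K - 1)) := Nat.mul_le_mul_left _ (Nat.succ_le_of_lt hlt)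
          _ ≤ k := Nat.mul_div_le k (K - 1)
      have e0 : ((b : ℕ) + 1) * (K - 1) = (b : ℕ) * (K - 1) + (K - 1) := by ring
      rw [e0] at hfull
      have e1 : K - 1 ≤ k + 1 - (b : ℕ) * (K - 1) := by omega
      have e2 : K - 1 ≤ k - (b : ℕ) * (K - 1) := by omega
      rw [Nat.min_eq_left e1, Nat.min_eq_left e2, Nat.add_zero]
    · -- b > k/(K-1): the row is empty at both steps
      have hemp : k + 1 ≤ (b : ℕ) * (K - 1) :=
        calc k + 1 ≤ (k / (K - 1) + 1) * (K - 1) := by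
              rw [Nat.add_mul, Nat.one_mul, Nat.mul_comm]; omega
          _ ≤ (b : ℕ) * (K - 1) := Nat.mul_le_mul_right _ (Nat.succ_le_of_lt hgt)
      have e1 : k + 1 - (b : ℕ) * (K - 1) = 0 := by omega
      have e2 : k - (b : ℕ) * (K - 1) = 0 := by omega
      rw [e1, e2, Nat.add_zero]

/-- consecutive chain terms alternate in sign. -/
theorem alternates (hK : 2 ≤ K) {k : ℕ} (hk : k < m * (K - 1)) :
    termSign (ee m K) (tgt m K (by omega) k) * termSign (ee m K) (tgt m K (by omega) (k + 1)) < 0 := by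
  have hK1 : 1 ≤ K := by omega
  have hb0 : k / (K - 1) < m := (Nat.div_lt_iff_lt_mul (by omega)).mpr hk
  unfold termSign tgt
  simp only [Equiv.Perm.sign_one, Units.val_one, one_mul]
  simp_rw [ee_tgt]
  have hsplit : ∏ b : Fin m, ((-1 : ℤ) ^ cl m K (k + 1) b) =
      (∏ b : Fin m, ((-1 : ℤ) ^ cl m K k b)) * ∏ b : Fin m, (if (b : ℕ) = k / (K - 1) then (-1 : ℤ) else 1) := by
    rw [← Finset.prod_mul_distrib]
    refine Finset.prod_congr rfl fun b _ => ?_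
    rw [cl_succ m K hK k b, pow_add]
    split_ifs <;> simp
  have hone : ∏ b : Fin m, (if (b : ℕ) = k / (K - 1) then (-1 : ℤ) else 1) = -1 := by
    rw [Finset.prod_ite, Finset.prod_const_one, mul_one, Finset.prod_const]
    have hcard : (Finset.univ.filter fun b : Fin m => (b : ℕ) = k / (K - 1)).card = 1 := by
      rw [Finset.card_eq_one]
      refine ⟨⟨k / (K - 1), hb0⟩, ?_⟩
      ext b
      simp only [Finset.mem_filter, Finset.mem_univ, true_and, Finset.mem_singleton]
      constructor
      · intro h; exact Fin.ext h
      · intro h; rw [h]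
    rw [hcard, pow_one]
  rw [hsplit, hone]
  have hsq : 0 < (∏ b : Fin m, ((-1 : ℤ) ^ cl m K k b)) * (∏ b : Fin m, ((-1 : ℤ) ^ cl m K k b)) := by
    have : (∏ b : Fin m, ((-1 : ℤ) ^ cl m K k b)) ≠ 0 :=
      Finset.prod_ne_zero_iff.mpr fun b _ => pow_ne_zero _ (by norm_num)
    exact mul_self_pos.mpr this
  nlinarith

/-- **The tropical census floor**: `TropRootLawAt m K B → m(K−1) ≤ B` (for `K ≥ 2`; the design above realises `m(K−1)`
alternations). [folklore] -/
theorem le_of_tropRootLawAt (hK : 2 ≤ K) {B : ℕ} (h : TropRootLawAt m K B) : m * (K - 1) ≤ B :=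
  h (dd K) (vv m K) (ee m K) (m * (K - 1)) (fun k => th k) (fun k => tgt m K (by omega) k) (ee_natAbs m K)
    (fun a b hab => by unfold th; have : (a : ℕ) < (b : ℕ) := hab; push_cast; omega)
    (fun k => isDominant_tgt m K (by omega) k)
    (fun k => by
      have := alternates m K hK (k := (k : ℕ)) k.isLt
      simpa only [Fin.val_castSucc, Fin.val_succ] using this)

/-- **The real census floor**: `PosRootLawAt m K B → m(K−1) ≤ B` — the design is symmetric, so symmetric patchworking
(`symmDesign_le_of_posRootLawAt`) lifts its chain to a real SYMMETRIC pencil of the same format with `m(K−1)` distinct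
positive zeros. [folklore] -/
theorem le_of_posRootLawAt (hK : 2 ≤ K) {B : ℕ} (h : PosRootLawAt m K B) : m * (K - 1) ≤ B :=
  symmDesign_le_of_posRootLawAt h (dd K) (vv m K) (ee m K) (vv_symm m K) (ee_symm m K) (ee_natAbs m K)
    (fun k => th k) (fun a b hab => by unfold th; have : (a : ℕ) < (b : ℕ) := hab; push_cast; omega)
    (fun k => tgt m K (by omega) k) (fun k => isDominant_tgt m K (by omega) k)
    (fun k => by
      have := alternates m K hK (k := (k : ℕ)) k.isLt
      simpa only [Fin.val_castSucc, Fin.val_succ] using this)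

/-- **`ζ₊(m,K) ≥ m(K−1)` for every format** with `m ≥ 1`, `K ≥ 2`: the row `PosRootLawAt m K (m(K−1) − 1)` is FALSE. [folklore] -/
theorem not_posRootLawAt (hK : 2 ≤ K) (hm : 1 ≤ m) : ¬ PosRootLawAt m K (m * (K - 1) - 1) := by
  intro h
  have h1 := le_of_posRootLawAt m K hK h
  have : 1 ≤ m * (K - 1) := Nat.one_le_iff_ne_zero.mpr (Nat.mul_ne_zero (by omega) (by omega))
  omega

/-- and a fortiori the all-real-zeros row `RealRootLawAt m K (m(K−1) − 1)` is false. [folklore] -/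
theorem not_realRootLawAt (hK : 2 ≤ K) (hm : 1 ≤ m) : ¬ RealRootLawAt m K (m * (K - 1) - 1) :=
  fun h => not_posRootLawAt m K hK hm (Census.posRootLawAt_of_realRootLawAt h)

end Summit.ValiantsHypothesis.ValiantsHypothesis.Theorems.LacunarySymmetroidMatrixDescartes.TropicalCensus.DiagK
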